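import Summits.CriticalPhenomena.Ising3DConformalLimit.Theorems.HyperoctahedralRPExistsScaleCovariantLimitFoldedCurrentUniqueness
import HarnessLib

/-!
# Standalone split glue — crux `ExistsScaleCovariantLimit` (item stmt-CriticalPhenomena-1981) ⟸ item 6150 ∧ item 4659,
# route `HyperoctahedralRP`'s copy, in a module importing no other route file

Prepared by crux-strategist s1 (`Cruxes/ExistsScaleCovariantLimit/SplitGlueStandalone.lean`, 2026-08-17) and landed by line
lead c17 as the registered sub-goal `hrp_crux_of_doubling_of_totallyDisconnected` of item 1981. Purpose: a CURRIED glue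
theorem `TwoPointDoubling → ClusterSetTotallyDisconnected → ExistsScaleCovariantLimit` living in a module that imports NO
route (`Theses`) file beyond those already in the import cone of
`Theorems/HyperoctahedralRPExistsScaleCovariantLimitFoldedCurrentUniqueness.lean` (p139907: `HyperoctahedralRP`,
`MirrorHoelderCompactness`, `ClusterRigidity`, `MonotoneRG`), so that a route split
`ExistsScaleCovariantLimit ⟶ TwoPointDoubling(6150) ∧ ClusterSetTotallyDisconnected(4659)` on any OTHER route sharing the
decl (PositivityBegetsConformality, PlanarCornerRotations, TauBallRounding, ModularBoosts, ModularQuarterTurn,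
HarmonicMomentsIsotropy, MarkovRigidity, ConformalPoissonDevice, UnitLightCone, OrthogonalFrameTP2, ArmHyperscaling,
VolterraWard, GaussianScaleMixture) can cite it as `--glue-by` without a cyclic import (all route copies of the three
decls have one body; the `HyperoctahedralRP`-typed term is accepted at each copy by `δ`-unfolding). The `MonotoneRG`
copy is served by `Theorems/MonotoneRGExistsScaleCovariantLimitSplitGlue.lean`. Composition of the landed exactness
theorem `FoldedCurrentRepulsion.crux_iff_doubling_and_totallyDisconnected` (p139907) only; no definitions.

References: H. Duminil-Copin, ICM 2022, §8.4 [DuminilCopinICM2022]; M. Aizenman, H. Duminil-Copin, Ann. of Math. 194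
(2021), arXiv:1912.07973, Remark 5.10 [AizenmanDuminilCopinAnnals2021].
-/

noncomputable section

namespace Summit.CriticalPhenomena.Ising3DConformalLimit.Cruxes.ExistsScaleCovariantLimit.SplitGlue

open Summit.CriticalPhenomena.Ising3DConformalLimit.Theses
open Summit.CriticalPhenomena.Ising3DConformalLimit.Cruxes.ExistsScaleCovariantLimit.FoldedCurrentRepulsion
  (crux_iff_doubling_and_totallyDisconnected)

/-- **Curried split glue, HyperoctahedralRP copy**: item 6150 `TwoPointDoubling` and item 4659 `ClusterSetTotallyDisconnected` imply the crux
`ExistsScaleCovariantLimit` (one line from `crux_iff_doubling_and_totallyDisconnected`, p139907). [folklore] -/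
theorem hrp_crux_of_doubling_of_totallyDisconnected : Summit.CriticalPhenomena.Ising3DConformalLimit.Theses.MirrorHoelderCompactness.TwoPointDoubling → Summit.CriticalPhenomena.Ising3DConformalLimit.Theses.ClusterRigidity.ClusterSetTotallyDisconnected → Summit.CriticalPhenomena.Ising3DConformalLimit.Theses.HyperoctahedralRP.ExistsScaleCovariantLimit :=
  fun hD hTD => crux_iff_doubling_and_totallyDisconnected.2 ⟨hD, hTD⟩

end Summit.CriticalPhenomena.Ising3DConformalLimit.Cruxes.ExistsScaleCovariantLimit.SplitGlue

end
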